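import Summits.AtomisticToContinuum.BoseEinsteinCondensation.Theorems.FibreConductance.Negative.DensityFlatteningCostNearMinimiser
import Summits.AtomisticToContinuum.BoseEinsteinCondensation.Theorems.BECThomsonPrincipleDefs

/-!
# Crux `FibreConductance` (stmt-AtomisticToContinuum-9480), line `parseval-shell-bootstrap` —
stub 5 `DensityFlattening`, exact form: (H1) cannot be relaxed to near-minimality

Refuter (drefute) support file.  `DensityFlatteningCostNearMinimiser.lean` refutes the near-minimiser
relaxation of stub 5 in FIRST-MOMENT form (`E_W[D] ≤ K L`).  Here the gap to the stub's EXACT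
conclusion (`E_W[D²] ≤ K L²`, i.e. `∫_{cellN} W·D² ≤ K L⁵` with `D = densCost` = the skeleton's
`fibreDensCost`) is closed by Cauchy–Schwarz in the bath, kernel-checked:
`fibreCost_le_of_densCost_sq_le` — for an admissible `Φ` and a measurable flow `J`,
`∫_{cellN} W·D² ≤ K L⁵ ⇒ fibreCost = E_W[D] ≤ √K·L` (Tonelli with the first particle split off,
`W` and `D` are functions of the bath point only, `E_W 1 = ‖Φ‖² = 1`, and the elementary
`x ≤ (t/2)x² + 1/(2t)` optimised in `t`).  Hence `not_densityFlatteningNearMinimiser`: the stub with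
(H1) relaxed to `periodicEnergy v Φ ≤ E₀ + δ` (any `δ > 0` chosen with `ρ₀, K, N₀`) is false; and
`densityFlatteningNearMinimiser_iff_defs` certifies by `Iff.rfl` that this mutated statement is the
lead's landed `ParsevalShellBootstrap.DensityFlattening` (`Theorems/BECThomsonPrincipleDefs.lean`) with
exactly that relaxation, in the lead's own vocabulary.  All [folklore].
-/

noncomputable section

namespace Summit.AtomisticToContinuum.BoseEinsteinCondensation.Theorems.FibreConductance.Negative

open MeasureTheory Literature.MathematicalPhysics.QuantumManyBody.BoseGas
open Summit.AtomisticToContinuum.BoseEinsteinCondensation.Theorems.GaussianDominationCan.Negative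
open scoped ENNReal NNReal ComplexConjugate

variable {m : ℕ} {L : ℝ}

/-! ### From the stub's second moment to the first moment: Cauchy–Schwarz in the bath -/

section SecondMoment

variable {φ : Config (m + 1) → ℂ} {J : Config (m + 1) → Fin 3 → ℂ}

/-- The stub's fibre cost `D(X̂) = ∫_cell |J(y,X̂)|²/ψ(y,X̂)² dy` (the skeleton's `fibreDensCost`, over
`FibreVocabulary.fibrePsi`). -/
def densCost (L : ℝ) (φ : Config (m + 1) → ℂ) (J : Config (m + 1) → Fin 3 → ℂ) (X : Config (m + 1)) :
    ℝ≥0∞ :=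
  ∫⁻ y in cell L, ENNReal.ofReal ((∑ l : Fin 3, ‖J (Function.update X 0 y) l‖ ^ 2) /
    fibrePsi L φ (Function.update X 0 y) ^ 2)

/-- Updating the head of a cons. [folklore] -/
theorem update_vecCons (x y : Space) (Y : Config m) :
    Function.update (Matrix.vecCons x Y : Config (m + 1)) 0 y = Matrix.vecCons y Y := by
  funext j
  refine Fin.cases ?_ (fun i => ?_) j
  · simp
  · rw [Function.update_of_ne (Fin.succ_ne_zero i)]; rfl

/-- `W` does not depend on the fibre variable. [folklore] -/
theorem fibreW_vecCons (x : Space) (Y : Config m) :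
    fibreW L φ (Matrix.vecCons x Y) = ∫ y in cell L, ‖φ (Matrix.vecCons y Y)‖ ^ 2 := by
  unfold fibreW; simp_rw [update_vecCons]

/-- `D` does not depend on the fibre variable. [folklore] -/
theorem densCost_vecCons (x : Space) (Y : Config m) :
    densCost L φ J (Matrix.vecCons x Y) = ∫⁻ y in cell L, ENNReal.ofReal
      ((∑ l : Fin 3, ‖J (Matrix.vecCons y Y) l‖ ^ 2) / fibrePsi L φ (Matrix.vecCons y Y) ^ 2) := by
  unfold densCost; simp_rw [update_vecCons]

/-- `W` is measurable (continuous `φ`). [folklore] -/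
theorem measurable_fibreW (hφ : Continuous φ) : Measurable (fibreW L φ) := by
  have h : StronglyMeasurable (Function.uncurry fun (X : Config (m + 1)) (y : Space) =>
      ‖φ (Function.update X 0 y)‖ ^ 2) :=
    ((hφ.comp (continuous_fst.update 0 continuous_snd)).norm.pow 2).stronglyMeasurable
  exact (h.integral_prod_right (ν := volume.restrict (cell L))).measurable

/-- `ψ` is measurable (continuous `φ`). [folklore] -/
theorem measurable_fibrePsi (hφ : Continuous φ) : Measurable (fibrePsi L φ) :=
  hφ.measurable.norm.div (measurable_fibreW hφ).sqrt

/-- The integrand `|J|²/ψ²` of `D` is measurable. [folklore] -/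
theorem measurable_densIntegrand (hφ : Continuous φ) (hJ : Measurable J) :
    Measurable fun X : Config (m + 1) =>
      ENNReal.ofReal ((∑ l : Fin 3, ‖J X l‖ ^ 2) / fibrePsi L φ X ^ 2) := by
  refine (Measurable.div (Finset.measurable_sum _ fun l _ => ?_)
    ((measurable_fibrePsi hφ).pow_const 2)).ennreal_ofReal
  exact ((measurable_pi_apply l).comp hJ).norm.pow_const 2

/-- `D` is measurable in the bath point. [folklore] -/
theorem measurable_densCost (hφ : Continuous φ) (hJ : Measurable J) : Measurable (densCost L φ J) := by
  unfold densCost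
  exact ((measurable_densIntegrand hφ hJ).comp measurable_update').lintegral_prod_right'

/-- Pointwise AM–GM in `ℝ≥0∞`: `x ≤ (t/2)x² + 1/(2t)` for `t > 0`. [folklore] -/
theorem ennreal_le_sq_add {t : ℝ} (ht : 0 < t) (x : ℝ≥0∞) :
    x ≤ ENNReal.ofReal (t / 2) * x ^ 2 + ENNReal.ofReal (1 / (2 * t)) := by
  rcases eq_or_ne x ⊤ with rfl | hx
  · rw [ENNReal.top_pow two_ne_zero, ENNReal.mul_top (by rw [ENNReal.ofReal_ne_zero_iff]; positivity)]
    exact le_top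
  · lift x to ℝ≥0 using hx
    have hr : 0 ≤ (x : ℝ) := x.2
    rw [show ((x : ℝ≥0) : ℝ≥0∞) = ENNReal.ofReal (x : ℝ) by simp, ← ENNReal.ofReal_pow hr,
      ← ENNReal.ofReal_mul (by positivity), ← ENNReal.ofReal_add (by positivity) (by positivity)]
    apply ENNReal.ofReal_le_ofReal
    have key : (x : ℝ) * (2 * t) ≤ (t / 2 * (x : ℝ) ^ 2 + 1 / (2 * t)) * (2 * t) := by
      rw [add_mul, div_mul_cancel₀ _ (by positivity)]
      nlinarith [sq_nonneg ((x : ℝ) * t - 1)]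
    exact le_of_mul_le_mul_right key (by positivity)

/-- **Cauchy–Schwarz in the bath.**  For an admissible state `Φ` and a measurable flow `J`, the
stub's second-moment bound `∫_{cellN} W·D² ≤ K L⁵` (`E_W[D²] ≤ K L²`) gives the first-moment bound
`fibreCost = ∫_{cellN}|J|²W/ψ² = E_W[D] ≤ √K · L` (because `∫_{cell^m} W = ‖Φ‖² = 1`). [folklore] -/
theorem fibreCost_le_of_densCost_sq_le (hL : 0 < L) (Φ : PeriodicTrialState (m + 1) L)
    (hJ : Measurable J) {K : ℝ} (hK : 0 ≤ K)
    (h : ∫⁻ X in cellN (m + 1) L, ENNReal.ofReal (fibreW L Φ.ψ X) * densCost L Φ.ψ J X ^ 2 ≤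
      ENNReal.ofReal (K * L ^ 5)) :
    fibreCost L Φ.ψ J ≤ ENNReal.ofReal (Real.sqrt K * L) := by
  have hφ : Continuous Φ.ψ := Φ.contDiff.continuous
  have hL3 : 0 < L ^ 3 := by positivity
  -- bath functions
  set Wb : Config m → ℝ := fun Y => ∫ y in cell L, ‖Φ.ψ (Matrix.vecCons y Y)‖ ^ 2 with hWb
  set Db : Config m → ℝ≥0∞ := fun Y => ∫⁻ y in cell L, ENNReal.ofReal
    ((∑ l : Fin 3, ‖J (Matrix.vecCons y Y) l‖ ^ 2) / fibrePsi L Φ.ψ (Matrix.vecCons y Y) ^ 2) with hDb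
  have hWb0 : ∀ Y, 0 ≤ Wb Y := fun Y => integral_nonneg fun y => by positivity
  -- Tonelli for the cost
  have hF₁ : Measurable fun X : Config (m + 1) =>
      ENNReal.ofReal ((∑ l : Fin 3, ‖J X l‖ ^ 2) * fibreW L Φ.ψ X / fibrePsi L Φ.ψ X ^ 2) := by
    refine (Measurable.div (Measurable.mul (Finset.measurable_sum _ fun l _ => ?_)
      (measurable_fibreW hφ)) ((measurable_fibrePsi hφ).pow_const 2)).ennreal_ofReal
    exact ((measurable_pi_apply l).comp hJ).norm.pow_const 2
  have hcost : fibreCost L Φ.ψ J = ∫⁻ Y in cellN m L, ENNReal.ofReal (Wb Y) * Db Y := by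
    unfold fibreCost
    rw [lintegral_cellN_succ L hF₁]
    refine lintegral_congr fun Y => ?_
    have hin : ∀ x, ENNReal.ofReal ((∑ l : Fin 3, ‖J (Matrix.vecCons x Y) l‖ ^ 2) *
        fibreW L Φ.ψ (Matrix.vecCons x Y) / fibrePsi L Φ.ψ (Matrix.vecCons x Y) ^ 2) =
        ENNReal.ofReal (Wb Y) * ENNReal.ofReal ((∑ l : Fin 3, ‖J (Matrix.vecCons x Y) l‖ ^ 2) /
          fibrePsi L Φ.ψ (Matrix.vecCons x Y) ^ 2) := by
      intro x
      rw [fibreW_vecCons, ← ENNReal.ofReal_mul (hWb0 Y)]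
      congr 1
      simp only [hWb]
      ring
    simp_rw [hin]
    rw [lintegral_const_mul' _ _ ENNReal.ofReal_ne_top]
  -- Tonelli for the second moment
  have hF₂ : Measurable fun X : Config (m + 1) =>
      ENNReal.ofReal (fibreW L Φ.ψ X) * densCost L Φ.ψ J X ^ 2 :=
    (measurable_fibreW hφ).ennreal_ofReal.mul ((measurable_densCost hφ hJ).pow_const 2)
  have hD2 : ENNReal.ofReal L ^ 3 * ∫⁻ Y in cellN m L, ENNReal.ofReal (Wb Y) * Db Y ^ 2 ≤
      ENNReal.ofReal (K * L ^ 5) := by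
    rw [lintegral_cellN_succ L hF₂] at h
    have hin : ∀ (Y : Config m) (x : Space), ENNReal.ofReal (fibreW L Φ.ψ (Matrix.vecCons x Y)) *
        densCost L Φ.ψ J (Matrix.vecCons x Y) ^ 2 = ENNReal.ofReal (Wb Y) * Db Y ^ 2 := by
      intro Y x
      rw [fibreW_vecCons, densCost_vecCons]
    simp_rw [hin] at h
    simp_rw [setLIntegral_const, volume_cell] at h
    rw [lintegral_mul_const' _ _ (ENNReal.pow_ne_top ENNReal.ofReal_ne_top), mul_comm] at h
    exact h
  have hD2' : ∫⁻ Y in cellN m L, ENNReal.ofReal (Wb Y) * Db Y ^ 2 ≤ ENNReal.ofReal (K * L ^ 2) := by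
    have hL3e : ENNReal.ofReal L ^ 3 = ENNReal.ofReal (L ^ 3) := (ENNReal.ofReal_pow hL.le 3).symm
    rw [hL3e] at hD2
    have hD2c : (∫⁻ Y in cellN m L, ENNReal.ofReal (Wb Y) * Db Y ^ 2) * ENNReal.ofReal (L ^ 3) ≤
        ENNReal.ofReal (K * L ^ 5) := by rw [mul_comm]; exact hD2
    have := (ENNReal.le_div_iff_mul_le (Or.inl ((ENNReal.ofReal_pos.mpr hL3).ne'))
      (Or.inl ENNReal.ofReal_ne_top)).mpr hD2c
    rw [← ENNReal.ofReal_div_of_pos hL3] at this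
    refine this.trans (le_of_eq ?_)
    congr 1
    field_simp
  -- normalisation `∫ W = 1`
  have hW1 : ∫⁻ Y in cellN m L, ENNReal.ofReal (Wb Y) = 1 := by
    have hn := Φ.norm_eq
    rw [lintegral_cellN_succ L (hφ.measurable.nnnorm.coe_nnreal_ennreal.pow_const 2)] at hn
    rw [← hn]
    refine lintegral_congr fun Y => ?_
    rw [hWb]
    simp only
    rw [ofReal_integral_eq_lintegral_ofReal]
    · refine lintegral_congr fun y => ?_
      rw [coe_nnnorm_sq_eq_ofReal]
    · exact integrableOn_cell ((hφ.comp (continuous_id.matrixVecCons continuous_const)).norm.pow 2)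
    · exact Filter.Eventually.of_forall fun y => by positivity
  -- measurability in the bath point
  have hDbm : Measurable Db := by
    have hG := measurable_densIntegrand (L := L) hφ hJ
    have hv : Measurable fun p : Config m × Space => (Matrix.vecCons p.2 p.1 : Config (m + 1)) :=
      (continuous_snd.matrixVecCons continuous_fst).measurable
    exact (hG.comp hv).lintegral_prod_right'
  have hWbm : Measurable Wb := by
    have e : Wb = fun Y => fibreW L Φ.ψ (Matrix.vecCons 0 Y) := by
      funext Y; rw [fibreW_vecCons]
    rw [e]
    exact (measurable_fibreW hφ).comp (continuous_const.matrixVecCons continuous_id).measurable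
  -- AM–GM and integration: for every `t > 0`, `cost ≤ (t/2) K L² + 1/(2t)`
  have hbound : ∀ t : ℝ, 0 < t →
      fibreCost L Φ.ψ J ≤ ENNReal.ofReal (t / 2 * (K * L ^ 2) + 1 / (2 * t)) := by
    intro t ht
    rw [hcost]
    calc ∫⁻ Y in cellN m L, ENNReal.ofReal (Wb Y) * Db Y
        ≤ ∫⁻ Y in cellN m L, (ENNReal.ofReal (t / 2) * (ENNReal.ofReal (Wb Y) * Db Y ^ 2) +
            ENNReal.ofReal (1 / (2 * t)) * ENNReal.ofReal (Wb Y)) := by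
          refine lintegral_mono fun Y => ?_
          calc ENNReal.ofReal (Wb Y) * Db Y ≤ ENNReal.ofReal (Wb Y) *
              (ENNReal.ofReal (t / 2) * Db Y ^ 2 + ENNReal.ofReal (1 / (2 * t))) :=
                mul_le_mul' le_rfl (ennreal_le_sq_add ht _)
            _ = ENNReal.ofReal (t / 2) * (ENNReal.ofReal (Wb Y) * Db Y ^ 2) +
                ENNReal.ofReal (1 / (2 * t)) * ENNReal.ofReal (Wb Y) := by ring
      _ = ENNReal.ofReal (t / 2) * (∫⁻ Y in cellN m L, ENNReal.ofReal (Wb Y) * Db Y ^ 2) +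
            ENNReal.ofReal (1 / (2 * t)) * ∫⁻ Y in cellN m L, ENNReal.ofReal (Wb Y) := by
          have hm : Measurable fun Y => ENNReal.ofReal (t / 2) * (ENNReal.ofReal (Wb Y) * Db Y ^ 2) :=
            (hWbm.ennreal_ofReal.mul (hDbm.pow_const 2)).const_mul _
          rw [lintegral_add_left hm, lintegral_const_mul' _ _ ENNReal.ofReal_ne_top,
            lintegral_const_mul' _ _ ENNReal.ofReal_ne_top]
      _ ≤ ENNReal.ofReal (t / 2) * ENNReal.ofReal (K * L ^ 2) + ENNReal.ofReal (1 / (2 * t)) * 1 := by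
          rw [hW1]
          gcongr
      _ = ENNReal.ofReal (t / 2 * (K * L ^ 2) + 1 / (2 * t)) := by
          rw [mul_one, ← ENNReal.ofReal_mul (by positivity),
            ← ENNReal.ofReal_add (by positivity) (by positivity)]
  -- finiteness and the square
  have hfin : fibreCost L Φ.ψ J ≠ ⊤ := ne_top_of_le_ne_top ENNReal.ofReal_ne_top (hbound 1 one_pos)
  set a : ℝ := (fibreCost L Φ.ψ J).toReal with ha
  have ha0 : 0 ≤ a := ENNReal.toReal_nonneg
  have h2 : ∀ t : ℝ, 0 < t → 2 * a ≤ t * (K * L ^ 2) + 1 / t := by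
    intro t ht
    have := ENNReal.toReal_le_of_le_ofReal (by positivity) (hbound t ht)
    rw [← ha] at this
    have e : t / 2 * (K * L ^ 2) + 1 / (2 * t) = (t * (K * L ^ 2) + 1 / t) / 2 := by
      field_simp
    rw [e] at this
    linarith
  have hsq : a ^ 2 ≤ K * L ^ 2 * 1 := sq_le_of_forall_two_mul_le ha0 (by positivity) zero_le_one h2
  have hle : a ≤ Real.sqrt K * L := by
    rw [mul_one] at hsq
    have h1 := Real.abs_le_sqrt hsq
    rw [abs_of_nonneg ha0, Real.sqrt_mul hK, Real.sqrt_sq hL.le] at h1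
    exact h1
  calc fibreCost L Φ.ψ J = ENNReal.ofReal a := (ENNReal.ofReal_toReal hfin).symm
    _ ≤ ENNReal.ofReal (Real.sqrt K * L) := ENNReal.ofReal_le_ofReal hle

end SecondMoment

/-! ### The stub's exact relaxation -/

/-- Stub 5 `DensityFlattening` of `Lines/parseval-shell-bootstrap.lean` VERBATIM (second-moment
conclusion `∫_{cellN} W·D² ≤ K L⁵`; `densCost`, `fibreW`, `fibrePsi`, `IsFibreFlow` are the skeleton's
`fibreDensCost`, `fibreW`, `fibrePsi`, `HasWeakDiv` up to unfolding) with the exact-minimiser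
hypothesis (H1) relaxed to `periodicEnergy v Φ ≤ E₀ + δ`, `δ > 0` chosen with `ρ₀, K, N₀`. -/
def DensityFlatteningNearMinimiser : Prop :=
  ∀ v : ℝ → ℝ≥0∞, IsRepulsiveFiniteRange v → (∃ B : ℝ, ∀ r, v r ≤ ENNReal.ofReal B) →
    ∃ ρ₀ K : ℝ, 0 < ρ₀ ∧ 0 < K ∧ ∃ N₀ : ℕ, ∃ δ : ℝ≥0∞, 0 < δ ∧ ∀ m : ℕ, N₀ ≤ m + 1 →
      ∀ L : ℝ, 0 < L → ((m + 1 : ℕ) : ℝ) ≤ ρ₀ * L ^ 3 →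
        ∀ Φ : PeriodicTrialState (m + 1) L,
          periodicEnergy v Φ ≤ periodicGroundStateEnergy v (m + 1) L + δ → (∀ X, Φ.ψ X ≠ 0) →
            ∃ J : Config (m + 1) → (Fin 3 → ℂ), Measurable J ∧
              IsFibreFlow m L (fun X => (((fibrePsi L Φ.ψ X ^ 2 - (L ^ 3)⁻¹ : ℝ)) : ℂ)) J ∧
                ∫⁻ X in cellN (m + 1) L, ENNReal.ofReal (fibreW L Φ.ψ X) * densCost L Φ.ψ J X ^ 2 ≤
                  ENNReal.ofReal (K * L ^ 5)

/-- The exact relaxation implies the first-moment one (with `√K`). [folklore] -/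
theorem densityFlatteningCostNearMinimiser_of (h : DensityFlatteningNearMinimiser) :
    DensityFlatteningCostNearMinimiser := by
  intro v hv hB
  obtain ⟨ρ₀, K, hρ, hK, N₀, δ, hδ, hmain⟩ := h v hv hB
  refine ⟨ρ₀, Real.sqrt K, hρ, Real.sqrt_pos.mpr hK, N₀, δ, hδ, fun m hm L hL hd Φ hE hz => ?_⟩
  obtain ⟨J, hJm, hJ, hD⟩ := hmain m hm L hL hd Φ hE hz
  exact ⟨J, hJ, fibreCost_le_of_densCost_sq_le hL Φ hJm hK.le hD⟩

/-- **(H1) of `stub_densityFlattening` cannot be relaxed to `δ`-near-minimality** (the stub's exact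
second-moment form). [folklore] -/
theorem not_densityFlatteningNearMinimiser : ¬ DensityFlatteningNearMinimiser :=
  fun h => not_densityFlatteningCostNearMinimiser (densityFlatteningCostNearMinimiser_of h)

/-- **Fidelity**: the mutated statement is the lead's landed `DensityFlattening`
(`Theorems/BECThomsonPrincipleDefs.lean`, namespace `…Cruxes.FibreConductance.ParsevalShellBootstrap`)
with `periodicEnergy v Φ = E₀` replaced by `periodicEnergy v Φ ≤ E₀ + δ` under `∃ δ > 0` —
definitionally, in the lead's own vocabulary (`HasWeakDiv`, `fibrePsi`, `fibreW`, `fibreDensCost`).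
[folklore] -/
theorem densityFlatteningNearMinimiser_iff_defs :
    DensityFlatteningNearMinimiser ↔
      ∀ v : ℝ → ℝ≥0∞, IsRepulsiveFiniteRange v → (∃ B : ℝ, ∀ r, v r ≤ ENNReal.ofReal B) →
        ∃ ρ₀ K : ℝ, 0 < ρ₀ ∧ 0 < K ∧ ∃ N₀ : ℕ, ∃ δ : ℝ≥0∞, 0 < δ ∧ ∀ m : ℕ, N₀ ≤ m + 1 →
          ∀ L : ℝ, 0 < L → ((m + 1 : ℕ) : ℝ) ≤ ρ₀ * L ^ 3 →
            ∀ Φ : PeriodicTrialState (m + 1) L,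
              periodicEnergy v Φ ≤ periodicGroundStateEnergy v (m + 1) L + δ → (∀ X, Φ.ψ X ≠ 0) →
                ∃ J : Config (m + 1) → (Fin 3 → ℂ), Measurable J ∧
                  Cruxes.FibreConductance.ParsevalShellBootstrap.HasWeakDiv L J
                    (fun X => (((Cruxes.FibreConductance.ParsevalShellBootstrap.fibrePsi Φ X ^ 2 -
                      (L ^ 3)⁻¹ : ℝ)) : ℂ)) ∧
                    ∫⁻ X in cellN (m + 1) L,
                      ENNReal.ofReal (Cruxes.FibreConductance.ParsevalShellBootstrap.fibreW Φ X) *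
                        Cruxes.FibreConductance.ParsevalShellBootstrap.fibreDensCost Φ J X ^ 2 ≤
                      ENNReal.ofReal (K * L ^ 5) :=
  Iff.rfl

end Summit.AtomisticToContinuum.BoseEinsteinCondensation.Theorems.FibreConductance.Negative

end
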